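import Summits.HubbardSuperconductivity.HubbardSuperconductivity.Theorems.NodalDiracTwistDiskTrivialHolonomy
import Summits.HubbardSuperconductivity.HubbardSuperconductivity.Theorems.NodalDiracTwistNodalDiracWeakCouplingAnnulusCore

/-!
# Route `NodalDiracTwist` — crux `NodalDiracWeakCoupling`, line `birth`: `stub_annulusInvariance`

Helper file for stmt-HubbardSuperconductivity-10370 (`NodalDiracWeakCoupling`): the stub
`stub_annulusInvariance` of the line `birth` — homotopy invariance of the `ℤ₂` holonomy. For the
spin-twisted Hubbard torus `H_L(U, φ) = spinTwistedHubbardTorus L U φ`: if the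
`(N, S^z = 0)`-sector ground state is unique up to scalars on the CLOSED ANNULUS
`r₁ ≤ |φ - p| ≤ r₂` (`0 < r₁ ≤ r₂`), and the cyclic overlap products of unit ground states on the
fine discretisations of the inner circle are eventually negative, then so are those on the outer
circle.

The abstract form `re_prod_cyclicOverlap_neg_of_annulus` is the annulus twin of
`re_prod_cyclicOverlap_pos` (`NodalDiracTwistDiskTrivialHolonomyCore`): `T`-real unit sections
(`exists_unit_groundState_fixed`) make all link variables real, `uniform_overlap_of_isCompact` on
the compact annulus makes nearby links close to `±1`, the cells of the fine shifted polar grid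
`p + (r₁ + (k/m)(r₂ - r₁)) (cos 2πj/n, sin 2πj/n)` have positive link product, and the ladder
identity `prod_cells_eq` gives `0 < C_k C_{k+1}` for the real loop products `C_k`, so the sign of
`C_0` (the inner circle, negative by hypothesis applied to the sections themselves) is transported
to `C_m` (the outer circle), where arbitrary unit phases cancel cyclically. The model inputs
(continuity, the antiunitary `T v = F v̄` with `F` the spin-exchange unitary, the coordinate
description of `szSector N 0`) are those of `diskTrivialHolonomy_twisted`
(`NodalDiracTwistDiskTrivialHolonomy`). Sources: Y. Hatsugai, J. Phys. Soc. Jpn. 75 (2006) 123601;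
T. Fukui, Y. Hatsugai, H. Suzuki, J. Phys. Soc. Jpn. 74 (2005) 1674. No new definitions.
-/

-- the mandated namespace `Summit.<Summit>.<Problem>.Theorems` repeats `HubbardSuperconductivity`
-- (single-problem summit, D-0017), which the `dupNamespace` linter flags on every declaration
set_option linter.dupNamespace false

namespace Summit.HubbardSuperconductivity.HubbardSuperconductivity.Theorems.NodalDiracTwist

open Matrix Complex Literature.MathematicalPhysics.QuantumLattice HubbardWave0
open scoped ComplexOrder

/-! ### The abstract annulus theorem -/

section Abstract

variable {ι : Type*} [Fintype ι]

/-- **Sign transport across an annulus (abstract form of `stub_annulusInvariance`).** Let `H φ`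
be a continuous family of matrices acting on the sector `K`, with the variational lower bound
`hlb` and existence `hex` of sector ground states, and let `T` be an ANTIUNITARY operation
preserving `K` and commuting with every `H φ`. If the sector ground state (`GS`, literally the
shape of `IsGroundStateInSector`) is unique up to scalars on the closed annulus
`r₁ ≤ |φ - p| ≤ r₂` (`0 < r₁ ≤ r₂`), and for all fine discretisations of the INNER circle and all
unit ground-state choices the cyclic overlap product has negative real part, then the same holds
on the OUTER circle.
Proof: `T`-real unit sections `s` exist on the annulus (`exists_unit_groundState_fixed`), so all
link variables `⟨s_φ, s_φ'⟩` are real; by `uniform_overlap_of_isCompact` nearby links are close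
to `±1`, every cell of the fine shifted polar grid
`p + (r₁ + (k/m)(r₂ - r₁)) (cos 2πj/n, sin 2πj/n)` has positive link product (`triangle_re_pos`
twice), and by the ladder identity `prod_cells_eq`
the real loop products `C_k` satisfy `0 < C_k C_{k+1}`; `C_0` is the cyclic product of the
sections on the inner circle, negative by hypothesis, hence `C_m < 0` (`neg_of_ladder`), and on
the outer circle arbitrary phases cancel cyclically (`prod_star_smul_dotProduct_smul`). Homotopy
invariance of the `ℤ₂` holonomy of a real line bundle in the lattice form of
Fukui–Hatsugai–Suzuki, J. Phys. Soc. Jpn. 74 (2005) 1674; Hatsugai, J. Phys. Soc. Jpn. 75 (2006)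
123601. [folklore] -/
theorem re_prod_cyclicOverlap_neg_of_annulus (K : Submodule ℂ (ι → ℂ))
    (H : (Fin 2 → ℝ) → Matrix ι ι ℂ) (hH : Continuous H)
    (hlb : ∀ φ, ∀ v ∈ K, star v ⬝ᵥ v = 1 → (H φ).minEnergyOn K ≤ (star v ⬝ᵥ H φ *ᵥ v).re)
    (hex : ∀ φ, ∃ v ∈ K, v ≠ 0 ∧ H φ *ᵥ v = (((H φ).minEnergyOn K : ℝ) : ℂ) • v)
    (GS : (Fin 2 → ℝ) → (ι → ℂ) → Prop)
    (hGS : ∀ φ χ, GS φ χ ↔ (χ ∈ K ∧ χ ≠ 0 ∧ H φ *ᵥ χ = (((H φ).minEnergyOn K : ℝ) : ℂ) • χ))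
    (T : (ι → ℂ) → (ι → ℂ)) (hTs : ∀ (c : ℂ) (v : ι → ℂ), T (c • v) = star c • T v)
    (hTK : ∀ v ∈ K, T v ∈ K) (hTH : ∀ φ v, T (H φ *ᵥ v) = H φ *ᵥ T v)
    (hTd : ∀ u v, star (T u) ⬝ᵥ T v = star (star u ⬝ᵥ v))
    (p : Fin 2 → ℝ) {r₁ r₂ : ℝ} (hr₁ : 0 < r₁) (hr₁₂ : r₁ ≤ r₂)
    (huniq : ∀ φ : Fin 2 → ℝ, r₁ ^ 2 ≤ (φ 0 - p 0) ^ 2 + (φ 1 - p 1) ^ 2 →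
      (φ 0 - p 0) ^ 2 + (φ 1 - p 1) ^ 2 ≤ r₂ ^ 2 →
      ∀ χ₁ χ₂ : ι → ℂ, GS φ χ₁ → GS φ χ₂ → ∃ z : ℂ, χ₂ = z • χ₁)
    (hinner : ∃ n₀ : ℕ, ∀ n ≥ n₀, ∀ ψ : Fin n → ι → ℂ,
      (∀ i : Fin n, GS (fun ν : Fin 2 => p ν + r₁ * (if ν = 0 then
          Real.cos (2 * Real.pi * (i : ℕ) / n) else Real.sin (2 * Real.pi * (i : ℕ) / n))) (ψ i) ∧
        star (ψ i) ⬝ᵥ ψ i = 1) →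
      (∏ i : Fin n, star (ψ i) ⬝ᵥ ψ (finRotate n i)).re < 0) :
    ∃ n₀ : ℕ, ∀ n ≥ n₀, ∀ ψ : Fin n → ι → ℂ,
      (∀ i : Fin n, GS (fun ν : Fin 2 => p ν + r₂ * (if ν = 0 then
          Real.cos (2 * Real.pi * (i : ℕ) / n) else Real.sin (2 * Real.pi * (i : ℕ) / n))) (ψ i) ∧
        star (ψ i) ⬝ᵥ ψ i = 1) →
      (∏ i : Fin n, star (ψ i) ⬝ᵥ ψ (finRotate n i)).re < 0 := by
  classical
  have hr₂ : 0 < r₂ := hr₁.trans_le hr₁₂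
  /- The closed annulus `A`: a closed subset of the compact disk of radius `r₂`. -/
  set A : Set (Fin 2 → ℝ) := {φ | r₁ ^ 2 ≤ (φ 0 - p 0) ^ 2 + (φ 1 - p 1) ^ 2 ∧
    (φ 0 - p 0) ^ 2 + (φ 1 - p 1) ^ 2 ≤ r₂ ^ 2} with hA
  have hcont : Continuous fun φ : Fin 2 → ℝ => (φ 0 - p 0) ^ 2 + (φ 1 - p 1) ^ 2 := by fun_prop
  have hAcl : IsClosed A :=
    (isClosed_le continuous_const hcont).inter (isClosed_le hcont continuous_const)
  have hAc : IsCompact A := (isCompact_disk p hr₂.le).of_isClosed_subset hAcl fun φ hφ => hφ.2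
  /- Step 0: `T`-real unit sections on the annulus; their links are real. -/
  have huniq' : ∀ φ ∈ A, ∀ χ₁ χ₂ : ι → ℂ,
      (χ₁ ∈ K ∧ χ₁ ≠ 0 ∧ H φ *ᵥ χ₁ = (((H φ).minEnergyOn K : ℝ) : ℂ) • χ₁) →
      (χ₂ ∈ K ∧ χ₂ ≠ 0 ∧ H φ *ᵥ χ₂ = (((H φ).minEnergyOn K : ℝ) : ℂ) • χ₂) →
      ∃ z : ℂ, χ₂ = z • χ₁ :=
    fun φ hφ χ₁ χ₂ h₁ h₂ => huniq φ hφ.1 hφ.2 χ₁ χ₂ ((hGS _ _).2 h₁) ((hGS _ _).2 h₂)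
  have hsec1 : ∀ φ : Fin 2 → ℝ, ∃ s : ι → ℂ, (φ ∈ A → GS φ s ∧ star s ⬝ᵥ s = 1 ∧ T s = s) := by
    intro φ
    by_cases hφ : φ ∈ A
    · obtain ⟨s, hs, hs1, hsT⟩ :=
        exists_unit_groundState_fixed K (H φ) (hex φ) T hTs hTK (hTH φ) hTd (huniq' φ hφ)
      exact ⟨s, fun _ => ⟨(hGS φ s).2 hs, hs1, hsT⟩⟩
    · exact ⟨0, fun h => absurd h hφ⟩
  choose sec hsec using hsec1
  have hreal : ∀ φ φ', φ ∈ A → φ' ∈ A →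
      star (sec φ) ⬝ᵥ sec φ' = (((star (sec φ) ⬝ᵥ sec φ').re : ℝ) : ℂ) := by
    intro φ φ' hφ hφ'
    have h := hTd (sec φ) (sec φ')
    rw [(hsec φ hφ).2.2, (hsec φ' hφ').2.2, Complex.star_def] at h
    exact (Complex.conj_eq_iff_re.1 h.symm).symm
  /- Step 1: uniform overlap `> 9/10` at scale `δ` on the compact annulus. -/
  obtain ⟨δ, hδ0, hδ⟩ :=
    uniform_overlap_of_isCompact K H hH hAc hlb huniq' (by norm_num : (0 : ℝ) < 1 / 10)
  have hov : ∀ φ φ', φ ∈ A → φ' ∈ A → dist φ φ' < δ →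
      9 / 10 < ‖star (sec φ) ⬝ᵥ sec φ'‖ ^ 2 := by
    intro φ φ' hφ hφ' hd
    have h := hδ φ hφ φ' hφ' hd (sec φ) (sec φ') ((hGS _ _).1 (hsec φ hφ).1) (hsec φ hφ).2.1
      ((hGS _ _).1 (hsec φ' hφ').1) (hsec φ' hφ').2.1
    linarith
  /- Step 2: real link variables; triangles and cells of nearby points are positive. -/
  set Lk : (Fin 2 → ℝ) → (Fin 2 → ℝ) → ℝ := fun φ φ' => (star (sec φ) ⬝ᵥ sec φ').re with hLk
  have hLsymm : ∀ φ φ', Lk φ' φ = Lk φ φ' := fun φ φ' => star_dotProduct_comm_re (sec φ) (sec φ')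
  have htri : ∀ a b c, a ∈ A → b ∈ A → c ∈ A →
      dist a b < δ → dist a c < δ → 0 < Lk a b * Lk b c * Lk c a := by
    intro a b c ha hb hc hab hac
    have h := triangle_re_pos (hsec a ha).2.1 (hsec b hb).2.1 (hsec c hc).2.1
      (hov a b ha hb hab) (hov a c ha hc hac)
    rw [hreal a b ha hb, hreal b c hb hc, hreal c a hc ha, ← Complex.ofReal_mul,
      ← Complex.ofReal_mul, Complex.ofReal_re] at h
    exact h
  have hcell : ∀ a b c d, a ∈ A → b ∈ A → c ∈ A → d ∈ A →
      dist a b < δ → dist a c < δ → dist a d < δ →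
      0 < Lk a b * Lk b c * Lk c d * Lk d a := by
    intro a b c d ha hb hc hd hab hac had
    have h12 := mul_pos (htri a b c ha hb hc hab hac) (htri a c d ha hc hd hac had)
    have hkey : Lk a b * Lk b c * Lk c a * (Lk a c * Lk c d * Lk d a) =
        (Lk a b * Lk b c * Lk c d * Lk d a) * (Lk a c * Lk a c) := by
      rw [hLsymm a c]; ring
    rw [hkey] at h12
    exact pos_of_mul_pos_left h12 (mul_self_nonneg _)
  /- Step 3: mesh parameters. -/
  obtain ⟨m, hm⟩ : ∃ m : ℕ, m = ⌈2 * (r₂ - r₁) / δ⌉₊ + 1 := ⟨_, rfl⟩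
  have hm0 : 0 < m := by rw [hm]; exact Nat.succ_pos _
  have hmR : (0 : ℝ) < m := by exact_mod_cast hm0
  have hrm : (r₂ - r₁) / m < δ / 2 := by
    have h1 : 2 * (r₂ - r₁) / δ < m := by
      rw [hm]; push_cast
      exact (Nat.le_ceil _).trans_lt (lt_add_one _)
    rw [div_lt_iff₀ hδ0] at h1
    rw [div_lt_iff₀ hmR]
    linarith
  obtain ⟨n₁, hn₁⟩ := hinner
  refine ⟨max n₁ (⌈4 * Real.pi * r₂ / δ⌉₊ + 1), ?_⟩
  intro n hn ψ hψ
  have hn1 : n₁ ≤ n := le_of_max_le_left hn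
  have hn2 : ⌈4 * Real.pi * r₂ / δ⌉₊ + 1 ≤ n := le_of_max_le_right hn
  have hn0 : 0 < n := by omega
  have hnR : (0 : ℝ) < n := by exact_mod_cast hn0
  have hrn : r₂ * (2 * Real.pi / n) < δ / 2 := by
    have h1 : (⌈4 * Real.pi * r₂ / δ⌉₊ : ℝ) < n := by
      exact_mod_cast Nat.lt_of_lt_of_le (Nat.lt_succ_self _) hn2
    have h2 : 4 * Real.pi * r₂ / δ < n := (Nat.le_ceil _).trans_lt h1
    rw [div_lt_iff₀ hδ0] at h2
    rw [show r₂ * (2 * Real.pi / n) = 2 * Real.pi * r₂ / n by ring, div_lt_iff₀ hnR]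
    linarith
  /- Step 4: the shifted polar grid `v k j = p + (r₁ + (k/m)(r₂ - r₁)) (cos 2πj/n, sin 2πj/n)`. -/
  set v : ℕ → ℕ → Fin 2 → ℝ := fun k j ν => p ν + (r₁ + (k : ℝ) / m * (r₂ - r₁)) *
    (if ν = 0 then Real.cos (2 * Real.pi * (j : ℝ) / n)
      else Real.sin (2 * Real.pi * (j : ℝ) / n)) with hv
  have hvA : ∀ k j, k ≤ m → v k j ∈ A :=
    fun k j hk => annulusGrid_mem p hr₁.le hr₁₂ hm0 n hk j
  have hθ : ∀ j : ℕ, |2 * Real.pi * (j : ℝ) / n - 2 * Real.pi * ((j + 1 : ℕ) : ℝ) / n| =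
      2 * Real.pi / n := by
    intro j
    rw [Nat.cast_add_one, show 2 * Real.pi * (j : ℝ) / n - 2 * Real.pi * ((j : ℝ) + 1) / n =
      -(2 * Real.pi / n) by ring, abs_neg, abs_of_pos (by positivity)]
  have hkk : ∀ k : ℕ, |(k : ℝ) / m - ((k + 1 : ℕ) : ℝ) / m| * (r₂ - r₁) = (r₂ - r₁) / m := by
    intro k
    rw [Nat.cast_add_one, show (k : ℝ) / m - ((k : ℝ) + 1) / m = -(1 / m) by ring, abs_neg,
      abs_of_pos (by positivity)]
    ring
  have hd_ab : ∀ k j, k ≤ m → dist (v k j) (v k (j + 1)) < δ := by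
    intro k j hk
    refine (dist_annulusGrid_le p hr₁.le hr₁₂ hm0 n hk k j (j + 1)).trans_lt ?_
    rw [hθ, sub_self, abs_zero, zero_mul, add_zero]
    linarith
  have hd_ad : ∀ k j, k + 1 ≤ m → dist (v k j) (v (k + 1) j) < δ := by
    intro k j hk
    refine (dist_annulusGrid_le p hr₁.le hr₁₂ hm0 n (Nat.le_of_succ_le hk) (k + 1) j j).trans_lt
      ?_
    rw [sub_self, abs_zero, mul_zero, zero_add, hkk]
    linarith
  have hd_ac : ∀ k j, k + 1 ≤ m → dist (v k j) (v (k + 1) (j + 1)) < δ := by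
    intro k j hk
    refine (dist_annulusGrid_le p hr₁.le hr₁₂ hm0 n (Nat.le_of_succ_le hk) (k + 1) j
      (j + 1)).trans_lt ?_
    rw [hθ, hkk]
    linarith
  -- periodicity in the angular index
  have hvrot : ∀ k (i : Fin n), v k (finRotate n i) = v k ((i : ℕ) + 1) := by
    intro k i
    have h := dir_finRotate i
    funext ν
    have hν := congrFun h ν
    change p ν + (r₁ + (k : ℝ) / m * (r₂ - r₁)) * _ = p ν + (r₁ + (k : ℝ) / m * (r₂ - r₁)) * _
    rw [hν]
  /- Step 5: the real loop products `C k`; the ladder makes their sign constant in `k`. -/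
  set C : ℕ → ℝ := fun k => ∏ i : Fin n, Lk (v k i) (v k ((i : ℕ) + 1)) with hC
  have hCsec : ∀ k, k ≤ m →
      ∏ i : Fin n, star (sec (v k i)) ⬝ᵥ sec (v k (finRotate n i)) = ((C k : ℝ) : ℂ) := by
    intro k hk
    change _ = (((∏ i : Fin n, Lk (v k i) (v k ((i : ℕ) + 1)) : ℝ)) : ℂ)
    rw [Complex.ofReal_prod]
    refine Finset.prod_congr rfl fun i _ => ?_
    rw [hvrot, hreal _ _ (hvA k i hk) (hvA k _ hk)]
  have hCC : ∀ k, k + 1 ≤ m → 0 < C k * C (k + 1) := by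
    intro k hk
    have hk' : k ≤ m := Nat.le_of_succ_le hk
    have hprod : 0 < ∏ i : Fin n, Lk (v k i) (v k ((i : ℕ) + 1)) *
        Lk (v k ((i : ℕ) + 1)) (v (k + 1) ((i : ℕ) + 1)) *
        Lk (v (k + 1) ((i : ℕ) + 1)) (v (k + 1) i) * Lk (v (k + 1) i) (v k i) :=
      Finset.prod_pos fun i _ => hcell _ _ _ _ (hvA k i hk') (hvA k _ hk') (hvA (k + 1) _ hk)
        (hvA (k + 1) i hk) (hd_ab k i hk') (hd_ac k i hk) (hd_ad k i hk)
    rw [prod_cells_eq Lk hLsymm (v k) (v (k + 1)) (hvrot k) (hvrot (k + 1))] at hprod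
    exact pos_of_mul_pos_left hprod (mul_self_nonneg _)
  /- Step 6: the inner circle `k = 0`: `C 0 < 0` by hypothesis, applied to the sections. -/
  have hpt0 : ∀ i : Fin n, (fun ν : Fin 2 => p ν + r₁ * (if ν = 0 then
      Real.cos (2 * Real.pi * (i : ℕ) / n) else Real.sin (2 * Real.pi * (i : ℕ) / n))) = v 0 i := by
    intro i
    funext ν
    change _ = p ν + (r₁ + ((0 : ℕ) : ℝ) / m * (r₂ - r₁)) * _
    rw [Nat.cast_zero, zero_div, zero_mul, add_zero]
  have hψ₀ : ∀ i : Fin n, GS (fun ν : Fin 2 => p ν + r₁ * (if ν = 0 then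
      Real.cos (2 * Real.pi * (i : ℕ) / n) else Real.sin (2 * Real.pi * (i : ℕ) / n)))
        (sec (v 0 i)) ∧ star (sec (v 0 i)) ⬝ᵥ sec (v 0 i) = 1 := fun i =>
    ⟨(congrArg (fun φ => GS φ (sec (v 0 i))) (hpt0 i)).mpr (hsec _ (hvA 0 i (Nat.zero_le _))).1,
      (hsec _ (hvA 0 i (Nat.zero_le _))).2.1⟩
  have hC0 : C 0 < 0 := by
    have h := hn₁ n hn1 (fun i => sec (v 0 i)) hψ₀
    rwa [hCsec 0 (Nat.zero_le _), Complex.ofReal_re] at h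
  /- Step 7: the outer circle `k = m`; phases cancel. -/
  have hpt : ∀ i : Fin n, (fun ν : Fin 2 => p ν + r₂ * (if ν = 0 then
      Real.cos (2 * Real.pi * (i : ℕ) / n) else Real.sin (2 * Real.pi * (i : ℕ) / n))) = v m i := by
    intro i
    funext ν
    change _ = p ν + (r₁ + (m : ℝ) / m * (r₂ - r₁)) * _
    rw [div_self hmR.ne', one_mul, show r₁ + (r₂ - r₁) = r₂ by ring]
  have hψ' : ∀ i : Fin n, GS (v m i) (ψ i) ∧ star (ψ i) ⬝ᵥ ψ i = 1 := fun i => by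
    rw [← hpt i]
    exact hψ i
  have hz : ∀ i : Fin n, ∃ z : ℂ, ψ i = z • sec (v m i) := fun i =>
    huniq (v m i) (hvA m i le_rfl).1 (hvA m i le_rfl).2 (sec (v m i)) (ψ i)
      (hsec _ (hvA m i le_rfl)).1 (hψ' i).1
  choose z hz using hz
  have hz1 : ∀ i, ‖z i‖ = 1 := fun i => by
    have h := (hψ' i).2
    rw [hz i] at h
    exact norm_eq_one_of_unit_smul (hsec _ (hvA m i le_rfl)).2.1 h
  have hprod : ∏ i : Fin n, star (ψ i) ⬝ᵥ ψ (finRotate n i) = ((C m : ℝ) : ℂ) := by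
    have h1 : ∏ i : Fin n, star (ψ i) ⬝ᵥ ψ (finRotate n i) =
        ∏ i : Fin n, star (z i • sec (v m i)) ⬝ᵥ
          (z (finRotate n i) • sec (v m (finRotate n i))) := by
      refine Finset.prod_congr rfl fun i _ => ?_
      rw [← hz i, ← hz (finRotate n i)]
    rw [h1, prod_star_smul_dotProduct_smul (finRotate n) z hz1 (fun i : Fin n => sec (v m i))]
    exact hCsec m le_rfl
  rw [hprod, Complex.ofReal_re]
  exact neg_of_ladder hCC hC0 le_rfl

end Abstract

/-! ### The spin-twisted torus -/

section Twisted

variable (L : ℕ) [NeZero L]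

/-- **Annulus invariance for the tree's `spinTwistedHubbardTorus`.** If the `(N, S^z = 0)`-sector
ground state of `H_L(U, φ)` is unique up to scalars on the closed annulus `r₁ ≤ |φ - p| ≤ r₂`
(`0 < r₁ ≤ r₂`) and the cyclic overlap products of unit ground states on the fine
discretisations of the inner circle are eventually negative, then so are those on the outer
circle. The abstract `re_prod_cyclicOverlap_neg_of_annulus` with `K = szSector N 0` (a coordinate
sector, so `sector_groundState` supplies existence and the variational bound; if the sector is
empty there are no ground states and the claim is vacuous) and the antiunitary `T v = F v̄`, `F`
the spin-exchange unitary, exactly as in `diskTrivialHolonomy_twisted`. Hatsugai, J. Phys. Soc.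
Jpn. 75 (2006) 123601; Fukui–Hatsugai–Suzuki, J. Phys. Soc. Jpn. 74 (2005) 1674. [folklore] -/
theorem annulusInvariance_twisted (U : ℝ) (N : ℕ) (p : Fin 2 → ℝ) {r₁ r₂ : ℝ} (hr₁ : 0 < r₁)
    (hr₁₂ : r₁ ≤ r₂)
    (huniq : ∀ φ : Fin 2 → ℝ, r₁ ^ 2 ≤ (φ 0 - p 0) ^ 2 + (φ 1 - p 1) ^ 2 →
      (φ 0 - p 0) ^ 2 + (φ 1 - p 1) ^ 2 ≤ r₂ ^ 2 →
      ∀ χ₁ χ₂ : Fock (Orb (FermionTorus 2 L)),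
        IsGroundStateInSector (spinTwistedHubbardTorus L U φ) N 0 χ₁ →
        IsGroundStateInSector (spinTwistedHubbardTorus L U φ) N 0 χ₂ → ∃ z : ℂ, χ₂ = z • χ₁)
    (hinner : ∃ n₀ : ℕ, ∀ n ≥ n₀, ∀ ψ : Fin n → Fock (Orb (FermionTorus 2 L)),
      (∀ i : Fin n,
        IsGroundStateInSector (spinTwistedHubbardTorus L U
            (fun ν : Fin 2 => p ν + r₁ *
                  (if ν = 0 then Real.cos (2 * Real.pi * (i : ℕ) / n)
                    else Real.sin (2 * Real.pi * (i : ℕ) / n)))) N 0 (ψ i) ∧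
          star (ψ i) ⬝ᵥ ψ i = 1) →
      (∏ i : Fin n, star (ψ i) ⬝ᵥ ψ (finRotate n i)).re < 0) :
    ∃ n₀ : ℕ, ∀ n ≥ n₀, ∀ ψ : Fin n → Fock (Orb (FermionTorus 2 L)),
      (∀ i : Fin n,
        IsGroundStateInSector (spinTwistedHubbardTorus L U
            (fun ν : Fin 2 => p ν + r₂ *
                  (if ν = 0 then Real.cos (2 * Real.pi * (i : ℕ) / n)
                    else Real.sin (2 * Real.pi * (i : ℕ) / n)))) N 0 (ψ i) ∧
          star (ψ i) ⬝ᵥ ψ i = 1) →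
      (∏ i : Fin n, star (ψ i) ⬝ᵥ ψ (finRotate n i)).re < 0 := by
  classical
  by_cases hp : ∃ s : Finset (Orb (FermionTorus 2 L)),
      s.card = N ∧ (upPart s).card = (downPart s).card
  · have hsg := fun φ : Fin 2 → ℝ => sector_groundState (spinTwistedHubbardTorus L U φ)
      (spinTwistedHubbardTorus_isHermitian L U φ)
      (fun s : Finset (Orb (FermionTorus 2 L)) => s.card = N ∧ (upPart s).card = (downPart s).card)
      hp (fun s s' hs hs' => spinTwistedHubbardTorus_apply_eq_zero L U φ N s s' hs hs')
      (szSector N 0) (mem_szSector_zero_iff_coord N)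
    set F := (fockRelabel (Orb.spinSwap : Orb (FermionTorus 2 L) ≃ Orb (FermionTorus 2 L))).val
      with hF
    have hTs : ∀ (c : ℂ) (v : Fock (Orb (FermionTorus 2 L))),
        F *ᵥ star (c • v) = star c • (F *ᵥ star v) := fun c v => by
      rw [star_smul, mulVec_smul]
    have hTK : ∀ v ∈ szSector N (0 : ℝ), F *ᵥ star v ∈ szSector N (0 : ℝ) := fun v hv =>
      fockRelabel_spinSwap_mulVec_mem_szSector (NodalDiracTwist.star_mem_szSector hv)
    have hTH : ∀ (φ : Fin 2 → ℝ) (v : Fock (Orb (FermionTorus 2 L))),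
        F *ᵥ star (spinTwistedHubbardTorus L U φ *ᵥ v) =
          spinTwistedHubbardTorus L U φ *ᵥ (F *ᵥ star v) := fun φ v =>
      fockRelabel_spinSwap_mulVec_star_mulVec L U φ v
    have hTd : ∀ u v : Fock (Orb (FermionTorus 2 L)),
        star (F *ᵥ star u) ⬝ᵥ (F *ᵥ star v) = star (star u ⬝ᵥ v) := fun u v => by
      rw [hF, star_fockRelabel_mulVec_dotProduct_fockRelabel_mulVec, star_star, dotProduct_star,
        dotProduct_comm]
    exact re_prod_cyclicOverlap_neg_of_annulus (szSector N 0) (spinTwistedHubbardTorus L U)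
      (continuous_spinTwistedHubbardTorus L U) (fun φ => (hsg φ).2) (fun φ => (hsg φ).1)
      (fun φ χ => IsGroundStateInSector (spinTwistedHubbardTorus L U φ) N 0 χ)
      (fun _ _ => Iff.rfl) (fun v => F *ᵥ star v) hTs hTK hTH hTd p hr₁ hr₁₂ huniq hinner
  · -- the sector is empty: there are no ground states at all
    push Not at hp
    refine ⟨1, fun n hn ψ hψ => ?_⟩
    obtain ⟨hmem, hne, -⟩ := (hψ ⟨0, by omega⟩).1
    exact (hne (funext fun s =>
      (mem_szSector_zero_iff_coord N _).1 hmem s fun h => hp s h.1 h.2)).elim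

/-- **`stub_annulusInvariance`** (line `birth` of crux stmt-HubbardSuperconductivity-10370,
`NodalDiracWeakCoupling`; homotopy invariance of the `ℤ₂` holonomy). For any `L, U, N`, centre
`p` and radii `0 < r₁ ≤ r₂`: if the `(N, S^z = 0)`-sector ground state of
`H_L(U, φ) = spinTwistedHubbardTorus L U φ` is unique up to scalars on the CLOSED ANNULUS
`r₁ ≤ |φ - p| ≤ r₂`, and the cyclic overlap products on the inner circle are eventually (in the
mesh) negative for all unit ground-state choices, then so are those on the outer circle. This is
`annulusInvariance_twisted` with the binders of the registered stub. Hatsugai, J. Phys. Soc.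
Jpn. 75 (2006) 123601; Fukui–Hatsugai–Suzuki, J. Phys. Soc. Jpn. 74 (2005) 1674. [folklore] -/
theorem stub_annulusInvariance :
    ∀ (L : ℕ) [NeZero L] (U : ℝ) (N : ℕ) (p : Fin 2 → ℝ) (r₁ r₂ : ℝ), 0 < r₁ → r₁ ≤ r₂ →
      (∀ φ : Fin 2 → ℝ, r₁ ^ 2 ≤ (φ 0 - p 0) ^ 2 + (φ 1 - p 1) ^ 2 →
        (φ 0 - p 0) ^ 2 + (φ 1 - p 1) ^ 2 ≤ r₂ ^ 2 →
        ∀ χ₁ χ₂ : Fock (Orb (FermionTorus 2 L)),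
          IsGroundStateInSector (spinTwistedHubbardTorus L U φ) N 0 χ₁ →
          IsGroundStateInSector (spinTwistedHubbardTorus L U φ) N 0 χ₂ → ∃ z : ℂ, χ₂ = z • χ₁) →
      (∃ n₀ : ℕ, ∀ n ≥ n₀, ∀ ψ : Fin n → Fock (Orb (FermionTorus 2 L)),
          (∀ i : Fin n,
            IsGroundStateInSector (spinTwistedHubbardTorus L U
                (fun ν : Fin 2 => p ν + r₁ *
                      (if ν = 0 then Real.cos (2 * Real.pi * (i : ℕ) / n)
                        else Real.sin (2 * Real.pi * (i : ℕ) / n)))) N 0 (ψ i) ∧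
              star (ψ i) ⬝ᵥ ψ i = 1) →
          (∏ i : Fin n, star (ψ i) ⬝ᵥ ψ (finRotate n i)).re < 0) →
      ∃ n₀ : ℕ, ∀ n ≥ n₀, ∀ ψ : Fin n → Fock (Orb (FermionTorus 2 L)),
        (∀ i : Fin n,
          IsGroundStateInSector (spinTwistedHubbardTorus L U
              (fun ν : Fin 2 => p ν + r₂ *
                    (if ν = 0 then Real.cos (2 * Real.pi * (i : ℕ) / n)
                      else Real.sin (2 * Real.pi * (i : ℕ) / n)))) N 0 (ψ i) ∧
            star (ψ i) ⬝ᵥ ψ i = 1) →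
        (∏ i : Fin n, star (ψ i) ⬝ᵥ ψ (finRotate n i)).re < 0 :=
  fun L _ U N p _ _ hr₁ hr₁₂ huniq hinner => annulusInvariance_twisted L U N p hr₁ hr₁₂ huniq hinner

end Twisted

end Summit.HubbardSuperconductivity.HubbardSuperconductivity.Theorems.NodalDiracTwist
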